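import Mathlib
import HarnessLib
import Summits.HubbardSuperconductivity.HubbardSuperconductivity.Theses.WeakCouplingBCS
import Summits.HubbardSuperconductivity.HubbardSuperconductivity.Theses.ChiralWindow
import Summits.HubbardSuperconductivity.HubbardSuperconductivity.Theorems.WeakCouplingBCSWcbcsBcsConstructionThinSufficiency

/-!
# Crux `WcbcsBcsConstruction` (stmt-HubbardSuperconductivity-2010): the THIN CRUX follows from the sibling crux
# `CwChiralConstruction` (stmt-HubbardSuperconductivity-1740) — hence crux 2 + stmt-1740 ⇒ the SUMMIT

Lead c5 of line `ladder-scale-certified-chain` (prover-line-stmt-HubbardSuperconductivity-2010-c5-0), 2026-08-17, rev c5-1.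

Lead c4 landed (`…ThinSufficiency.lean`, p144261) that the route's deciding theorem only needs the THIN CRUX
`∀ U₁ > 0 ∃ U ∈ (0,U₁) ∃ δ ∈ (0,1/2) ∃ μ, n_L(U,μ) → 1-δ ∧ HasDWaveOrder U μ` next to crux 2 `WcbcsSsbToTorusLRO`.
This file records the cross-route observation that the thin crux is IMPLIED by route `ChiralWindow`'s constructive crux
`CwChiralConstruction` (stmt-1740: `∃ U₀ > 0 ∃ C > 0 ∀ U ∈ (0,U₀) ∃ δ ∈ [3/10, 12/25] ∃ μ, n_L(U,μ) → 1-δ ∧ e^{-C/U²} ≤ m(U,μ)`):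
its doping window `[3/10, 12/25]` lies inside `(0, 1/2)` and a positive floor gives `HasDWaveOrder` (`hasDWaveOrder_iff`).  Consequences
(all sorry-free, standard axioms):

* `wcbcs_thinCrux_of_cwChiralConstruction : CwChiralConstruction → thin crux`;
* `hubbardSuperconductivity_of_wcbcsSsbToTorusLRO_of_cwChiralConstruction : WcbcsSsbToTorusLRO → CwChiralConstruction → HubbardSuperconductivity`
  — the summit from crux 2 of route `WeakCouplingBCS` and the constructive crux of route `ChiralWindow`; so the two routes' open
  constructive content can be carried by ONE item (the skeleton rev c5-1 of this crux and rev c7-1 of stmt-1740 register the SAME stubs: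
  the one-point Kohn–Luttinger certificate (P1)(P2)(P3) and the local-uniform mechanism (M_loc) `stub_dWaveOrderFloorOnLeadingWindows`).

No converse is claimed: the typed crux 4 (one `U`-uniform `δ ∈ (0,1/2)`) does not give `δ ∈ [3/10, 12/25]`, and `CwChiralConstruction`
(`δ` depending on `U`) does not give a `U`-uniform `δ`.
-/

set_option linter.dupNamespace false

namespace Summit.HubbardSuperconductivity.HubbardSuperconductivity.Theorems

open Literature.MathematicalPhysics.QuantumLattice Filter
open Summit.HubbardSuperconductivity.HubbardSuperconductivity.Theses.WeakCouplingBCS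
open Summit.HubbardSuperconductivity.HubbardSuperconductivity.Theses.ChiralWindow
open scoped Topology

/-- **The sibling crux implies the thin crux.** `CwChiralConstruction` (stmt-1740) gives, for every `U ∈ (0, U₀)`, a doping
`δ(U) ∈ [3/10, 12/25] ⊂ (0, 1/2)`, a density-matched `μ` and the floor `e^{-C/U²} ≤ dWaveOrderParameter U μ`, hence `HasDWaveOrder U μ`;
given `U₁ > 0` take `U := min U₀ U₁ / 2`. [cite: KomaTasaki1994, §1] -/
theorem wcbcs_thinCrux_of_cwChiralConstruction (h : CwChiralConstruction) :
    ∀ U₁ : ℝ, 0 < U₁ → ∃ U ∈ Set.Ioo (0:ℝ) U₁, ∃ δ ∈ Set.Ioo (0:ℝ) (1 / 2), ∃ μ : ℝ,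
      Tendsto (fun L : ℕ => ((hubbardTorusWith 2 (L + 1) 1 U μ).groundStateFunctional
        totalNumber).re / ((L + 1 : ℕ) : ℝ) ^ 2) atTop (𝓝 (1 - δ)) ∧ HasDWaveOrder U μ := by
  intro U₁ hU₁
  obtain ⟨U₀, hU₀, C, -, H⟩ := h
  have hpos : (0:ℝ) < min U₀ U₁ / 2 := half_pos (lt_min hU₀ hU₁)
  have hlt : min U₀ U₁ / 2 < min U₀ U₁ := half_lt_self (lt_min hU₀ hU₁)
  obtain ⟨δ, hδ, μ, hd, hm⟩ := H _ ⟨hpos, lt_of_lt_of_le hlt (min_le_left _ _)⟩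
  exact ⟨_, ⟨hpos, lt_of_lt_of_le hlt (min_le_right _ _)⟩, δ, ⟨by linarith [hδ.1], by linarith [hδ.2]⟩, μ, hd,
    (hasDWaveOrder_iff _ _).2 (lt_of_lt_of_le (Real.exp_pos _) hm)⟩

/-- **The summit from crux 2 of `WeakCouplingBCS` and the constructive crux of `ChiralWindow`.** `WcbcsSsbToTorusLRO` (stmt-2009)
and `CwChiralConstruction` (stmt-1740) imply `HubbardSuperconductivity`, through the thin crux and lead c4's landed
`hubbardSuperconductivity_of_wcbcsSsbToTorusLRO_of_thinCrux`. [cite: KomaTasaki1994, §1] -/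
theorem hubbardSuperconductivity_of_wcbcsSsbToTorusLRO_of_cwChiralConstruction (h2 : WcbcsSsbToTorusLRO)
    (h : CwChiralConstruction) : _root_.HubbardSuperconductivity :=
  hubbardSuperconductivity_of_wcbcsSsbToTorusLRO_of_thinCrux h2 (wcbcs_thinCrux_of_cwChiralConstruction h)

/-- **Arrow form** (for the ledger's `supports` record of crux stmt-2010): crux 2 and the sibling crux give the summit.
[cite: KomaTasaki1994, §1] -/
theorem stub_summitOfSsbToTorusLROAndChiralConstruction : Summit.HubbardSuperconductivity.HubbardSuperconductivity.Theses.WeakCouplingBCS.WcbcsSsbToTorusLRO → Summit.HubbardSuperconductivity.HubbardSuperconductivity.Theses.ChiralWindow.CwChiralConstruction → _root_.HubbardSuperconductivity :=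
  fun h2 h => hubbardSuperconductivity_of_wcbcsSsbToTorusLRO_of_cwChiralConstruction h2 h

end Summit.HubbardSuperconductivity.HubbardSuperconductivity.Theorems
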